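import Literature.Algebra.Homology.EulerPoincareFormula
import Mathlib.Algebra.Homology.HomologySequence
import Mathlib.Algebra.Homology.QuasiIso
import HarnessLib

/-!
# Additivity of Mathlib's `eulerChar` in a short exact sequence of complexes; the pairing lemma; invariance

Layer `Literature/Algebra/Homology` (pure linear algebra over Mathlib; proved theorems only, 0 definitions, 0 named
facts, no instances, no notation). FILE 1 of 2 (FILE 2 = `HomologyEulerCharacteristicShortExact`, the `homologyEulerChar`
additivity via the long exact homology sequence). For complexes of vector spaces over a division ring `K`, of ANY shape `c`
carrying `ComplexShape.EulerCharSigns`: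

* ranks along exact sequences of spaces: `finrank_range_add_of_exact` (`rk g + rk f = dim X₂`), `moduleFinite_X₂_of_exact`,
  `finrank_X₂_eq_add_of_shortExact` (`dim X₂ = dim X₁ + dim X₃`);
* **the abstract pairing lemma `finsum_χ_mul_eq_neg_of_pairing`**: for `a b : ι → ℕ` with `b j = 0` at degrees without
  predecessor, `a i = 0` at degrees without successor and `b j = a i` across every step `c.Rel i j`,
  `∑ᶠ j, χ(j) b j = − ∑ᶠ i, χ(i) a i` (reindex along `prev`, `χ(next i) = −χ(i)`; no finiteness) — row (E-1)'s
  `EulerPoincare.finsum_χ_mul_finrank_range_d_prev_eq_neg` pattern for arbitrary data; `hasFiniteSupport_χ_mul_of_le`;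
* **`eulerChar_X₂_eq_add` — `χ(X₂) = χ(X₁) + χ(X₃)`** for Mathlib's `HomologicalComplex.eulerChar` along
  `S : ShortComplex (HomologicalComplex (ModuleCat K) c)` with `S.ShortExact`, `X₁`, `X₃` degreewise finite-dimensional with
  finite `finrankSupport` (`dim X₂ⁱ = dim X₁ⁱ + dim X₃ⁱ` via `ShortExact.map_of_exact (eval _ _ i)`; `finrankSupport_X₂_subset`);
* `eulerChar_eq_of_iso`, `homologyEulerChar_eq_of_iso`, **`homologyEulerChar_eq_of_quasiIso`** (invariance one-liners).

Different statements in the tree (cited, not restated): `Literature.Algebra.Homology.EulerCharacteristicAdditive`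
(`TopCohomology.eulerChar_eq_of_shortExact`: cochain `ℤ`, `Σ_{q ≤ r} (−1)^q h^q`, cut-offs `H⁻¹(X₃) = 0 = H^{r+1}(X₁)`) and
`AlgebraicTopology/SingularHomology/EulerCharacteristicTriple` (`eulerSum` bookkeeping of an `ℕ`-graded long exact sequence).
Mathlib (pin v4.32) has no additivity or invariance lemma for its `eulerChar` (`lean search 'eulerChar'`).

Library only (cell `pub-hodge-ring2`, count-neutral); proves nothing about any crux, route or conjecture.

## References

* U. Görtz, T. Wedhorn, *Algebraic Geometry II* (2023), Remark 23.62 (2) with Definition∕Remark 23.59. [GortzWedhorn2023]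
* A. Hatcher, *Algebraic Topology* (2002), §2.2, Thm. 2.44 and the rank bookkeeping in its proof. [HatcherAT2002]
* S. Lang, *Algebra* (2002), Ch. XX §3 (Euler characteristic and the Grothendieck group). [Lang2002]
-/

open CategoryTheory CategoryTheory.Limits

universe v u w

namespace Literature.Algebra.Homology.EulerCharShortExact

variable {K : Type u} [DivisionRing K]

/-! ### Ranks along exact sequences of vector spaces -/

/-- Rank–nullity along an exact `X₁ → X₂ → X₃`, `X₂` finite-dimensional: `rk g + rk f = dim X₂`. [cite: HatcherAT2002, Thm. 2.44 (proof)] -/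
theorem finrank_range_add_of_exact {T : ShortComplex (ModuleCat.{v} K)} (hT : T.Exact) [Module.Finite K T.X₂] :
    Module.finrank K (LinearMap.range T.g.hom) + Module.finrank K (LinearMap.range T.f.hom) =
      Module.finrank K T.X₂ := by
  have h1 := LinearMap.finrank_range_add_finrank_ker T.g.hom
  rwa [← hT.moduleCat_range_eq_ker] at h1

/-- In an exact `X₁ → X₂ → X₃` with `X₁`, `X₃` finite-dimensional, so is `X₂`. [cite: HatcherAT2002, §2.2 (proof of Lemma 2.34 (c))] -/
theorem moduleFinite_X₂_of_exact {T : ShortComplex (ModuleCat.{v} K)} (hT : T.Exact) [Module.Finite K T.X₁]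
    [Module.Finite K T.X₃] : Module.Finite K T.X₂ := by
  have h1 : ((⊤ : Submodule K T.X₂).map T.g.hom).FG := Module.Finite.iff_fg.1 inferInstance
  have h2 : ((⊤ : Submodule K T.X₂) ⊓ LinearMap.ker T.g.hom).FG := by
    rw [top_inf_eq, ← hT.moduleCat_range_eq_ker, LinearMap.range_eq_map]
    exact Submodule.FG.map _ Module.Finite.fg_top
  exact ⟨Submodule.fg_of_fg_map_of_fg_inf_ker T.g.hom h1 h2⟩

/-- In a short exact `0 → X₁ → X₂ → X₃ → 0` of vector spaces with `X₁`, `X₃` finite-dimensional,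
`dim X₂ = dim X₁ + dim X₃`. [cite: HatcherAT2002, Thm. 2.44 (proof)] -/
theorem finrank_X₂_eq_add_of_shortExact {T : ShortComplex (ModuleCat.{v} K)} (hT : T.ShortExact)
    [Module.Finite K T.X₁] [Module.Finite K T.X₃] :
    Module.finrank K T.X₂ = Module.finrank K T.X₁ + Module.finrank K T.X₃ := by
  haveI := moduleFinite_X₂_of_exact hT.exact
  rw [← finrank_range_add_of_exact hT.exact,
    LinearMap.finrank_range_of_inj ((ModuleCat.mono_iff_injective _).1 hT.mono_f),
    LinearMap.range_eq_top.2 ((ModuleCat.epi_iff_surjective _).1 hT.epi_g), finrank_top, add_comm]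

/-! ### The abstract pairing lemma -/

variable {ι : Type w} {c : ComplexShape ι}

/-- **Pairing lemma**: if `b j = 0` whenever `j` has no predecessor, `a i = 0` whenever `i` has no successor, and
`b j = a i` whenever `c.Rel i j`, then `∑ᶠ j, χ(j) b j = − ∑ᶠ i, χ(i) a i` (reindex along `prev : {Rel (prev j) j} →
{Rel i (next i)}` and use `χ(next i) = −χ(i)`; no finiteness needed). [cite: HatcherAT2002, Thm. 2.44 (proof)] -/
theorem finsum_χ_mul_eq_neg_of_pairing [c.EulerCharSigns] (a b : ι → ℕ)
    (hb : ∀ j, ¬c.Rel (c.prev j) j → b j = 0) (ha : ∀ i, ¬c.Rel i (c.next i) → a i = 0)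
    (hab : ∀ i j, c.Rel i j → b j = a i) :
    ∑ᶠ j, (c.χ j : ℤ) * (b j : ℤ) = -∑ᶠ i, (c.χ i : ℤ) * (a i : ℤ) := by
  set S : Set ι := {j | c.Rel (c.prev j) j} with hS
  set T : Set ι := {i | c.Rel i (c.next i)} with hT
  have hbij : Set.BijOn c.prev S T := by
    refine ⟨fun j hj => ?_, fun j hj j' hj' h => ?_, fun i hi => ?_⟩
    · show c.Rel (c.prev j) (c.next (c.prev j))
      rwa [c.next_eq' hj]
    · have h1 := c.next_eq' (show c.Rel (c.prev j) j from hj)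
      have h2 := c.next_eq' (show c.Rel (c.prev j') j' from hj')
      rw [← h1, ← h2, h]
    · refine ⟨c.next i, ?_, c.prev_eq' hi⟩
      show c.Rel (c.prev (c.next i)) (c.next i)
      rwa [c.prev_eq' hi]
  have lhs : ∑ᶠ j, (c.χ j : ℤ) * (b j : ℤ) = ∑ᶠ j ∈ S, (c.χ j : ℤ) * (b j : ℤ) := by
    rw [finsum_mem_def, Set.indicator_eq_self.2]
    intro j hj
    by_contra hj'
    exact hj (by simp only [hb j hj', Nat.cast_zero, mul_zero])
  have rhs : ∑ᶠ i, (c.χ i : ℤ) * (a i : ℤ) = ∑ᶠ i ∈ T, (c.χ i : ℤ) * (a i : ℤ) := by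
    rw [finsum_mem_def, Set.indicator_eq_self.2]
    intro i hi
    by_contra hi'
    exact hi (by simp only [ha i hi', Nat.cast_zero, mul_zero])
  rw [lhs, rhs, finsum_mem_eq_of_bijOn (g := fun i => -((c.χ i : ℤ) * (a i : ℤ))) c.prev hbij ?_]
  · simp only [finsum_neg_distrib]
  · intro j hj
    have hrel : c.Rel (c.prev j) j := hj
    have h1 : c.next (c.prev j) = j := c.next_eq' hrel
    have h2 : (c.χ j : ℤ) = -(c.χ (c.prev j) : ℤ) := by
      conv_lhs => rw [← h1]
      rw [c.χ_next (show c.Rel (c.prev j) (c.next (c.prev j)) by rwa [h1]), Units.val_neg]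
    rw [h2, hab _ _ hrel, neg_mul]

/-- A signed `ℕ`-valued function dominated by the ranks of a graded object with finite rank support has finite
support. [cite: HatcherAT2002, Thm. 2.44 (proof)] -/
theorem hasFiniteSupport_χ_mul_of_le [c.EulerCharSigns] {X : GradedObject ι (ModuleCat.{v} K)}
    (hX : (GradedObject.finrankSupport X).Finite) {g : ι → ℕ} (hg : ∀ i, g i ≤ Module.finrank K (X i)) :
    (fun i => (c.χ i : ℤ) * (g i : ℤ)).HasFiniteSupport := by
  refine hX.subset fun i hi => ?_
  have := hg i
  simp only [GradedObject.finrankSupport, Function.mem_support, ne_eq, mul_eq_zero, Units.ne_zero,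
    Int.natCast_eq_zero, false_or] at hi ⊢
  omega

/-! ### Additivity of `eulerChar` -/

variable {S : ShortComplex (HomologicalComplex (ModuleCat.{v} K) c)}

/-- In a short exact sequence of complexes with `X₁ⁱ`, `X₃ⁱ` finite-dimensional, so is `X₂ⁱ`. [cite: HatcherAT2002, §2.2] -/
theorem moduleFinite_X_X₂ (hS : S.ShortExact) (i : ι) [Module.Finite K (S.X₁.X i)] [Module.Finite K (S.X₃.X i)] :
    Module.Finite K (S.X₂.X i) :=
  haveI : Module.Finite K (S.map (HomologicalComplex.eval _ _ i)).X₁ := inferInstanceAs (Module.Finite K (S.X₁.X i))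
  haveI : Module.Finite K (S.map (HomologicalComplex.eval _ _ i)).X₃ := inferInstanceAs (Module.Finite K (S.X₃.X i))
  moduleFinite_X₂_of_exact (T := S.map (HomologicalComplex.eval _ _ i))
    (hS.map_of_exact (HomologicalComplex.eval _ _ i)).exact

/-- Degreewise `dim X₂ⁱ = dim X₁ⁱ + dim X₃ⁱ` in a short exact sequence of complexes. [cite: HatcherAT2002, Thm. 2.44 (proof)] -/
theorem finrank_X_X₂_eq_add (hS : S.ShortExact) (i : ι) [Module.Finite K (S.X₁.X i)] [Module.Finite K (S.X₃.X i)] :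
    Module.finrank K (S.X₂.X i) = Module.finrank K (S.X₁.X i) + Module.finrank K (S.X₃.X i) :=
  haveI : Module.Finite K (S.map (HomologicalComplex.eval _ _ i)).X₁ := inferInstanceAs (Module.Finite K (S.X₁.X i))
  haveI : Module.Finite K (S.map (HomologicalComplex.eval _ _ i)).X₃ := inferInstanceAs (Module.Finite K (S.X₃.X i))
  finrank_X₂_eq_add_of_shortExact (T := S.map (HomologicalComplex.eval _ _ i))
    (hS.map_of_exact (HomologicalComplex.eval _ _ i))

/-- The rank support of `X₂` lies in the union of those of `X₁` and `X₃`. [cite: HatcherAT2002, §2.2] -/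
theorem finrankSupport_X₂_subset (hS : S.ShortExact) [∀ i, Module.Finite K (S.X₁.X i)]
    [∀ i, Module.Finite K (S.X₃.X i)] :
    GradedObject.finrankSupport S.X₂.X ⊆ GradedObject.finrankSupport S.X₁.X ∪ GradedObject.finrankSupport S.X₃.X := by
  intro i hi
  simp only [GradedObject.finrankSupport, Function.mem_support, ne_eq, Set.mem_union] at hi ⊢
  rw [finrank_X_X₂_eq_add hS i] at hi
  omega

/-- **`χ(X₂) = χ(X₁) + χ(X₃)`** for Mathlib's `HomologicalComplex.eulerChar` along a short exact sequence of complexes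
of any shape, when `X₁` and `X₃` are degreewise finite-dimensional with finitely many non-zero terms.
[cite: GortzWedhorn2023, Remark 23.62 (2)] [cite: HatcherAT2002, Thm. 2.44 (proof)] -/
theorem eulerChar_X₂_eq_add [c.EulerCharSigns] (hS : S.ShortExact) [∀ i, Module.Finite K (S.X₁.X i)]
    [∀ i, Module.Finite K (S.X₃.X i)] (h₁ : (GradedObject.finrankSupport S.X₁.X).Finite)
    (h₃ : (GradedObject.finrankSupport S.X₃.X).Finite) :
    S.X₂.eulerChar = S.X₁.eulerChar + S.X₃.eulerChar := by
  simp only [HomologicalComplex.eulerChar, GradedObject.eulerChar]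
  rw [← finsum_add_distrib (hasFiniteSupport_χ_mul_of_le h₁ fun i => le_rfl)
    (hasFiniteSupport_χ_mul_of_le h₃ fun i => le_rfl)]
  refine finsum_congr fun i => ?_
  rw [finrank_X_X₂_eq_add hS i]
  push_cast
  ring

/-! ### Invariance -/

/-- Isomorphic complexes have the same Euler characteristic. [cite: Lang2002, XX §3] -/
theorem eulerChar_eq_of_iso [c.EulerCharSigns] {C D : HomologicalComplex (ModuleCat.{v} K) c} (e : C ≅ D) :
    C.eulerChar = D.eulerChar := by
  simp only [HomologicalComplex.eulerChar, GradedObject.eulerChar]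
  refine finsum_congr fun i => ?_
  have e' : C.X i ≅ D.X i := (HomologicalComplex.eval _ _ i).mapIso e
  rw [LinearEquiv.finrank_eq e'.toLinearEquiv]

/-- Isomorphic complexes have the same homological Euler characteristic. [cite: Lang2002, XX §3] -/
theorem homologyEulerChar_eq_of_iso [c.EulerCharSigns] {C D : HomologicalComplex (ModuleCat.{v} K) c} (e : C ≅ D) :
    C.homologyEulerChar = D.homologyEulerChar := by
  simp only [HomologicalComplex.homologyEulerChar, GradedObject.eulerChar]
  refine finsum_congr fun i => ?_
  have e' : C.homology i ≅ D.homology i := (HomologicalComplex.homologyFunctor _ _ i).mapIso e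
  rw [LinearEquiv.finrank_eq e'.toLinearEquiv]

/-- **The homological Euler characteristic is a quasi-isomorphism invariant.** [cite: GortzWedhorn2023, Definition 23.59] -/
theorem homologyEulerChar_eq_of_quasiIso [c.EulerCharSigns] {C D : HomologicalComplex (ModuleCat.{v} K) c} (f : C ⟶ D)
    [QuasiIso f] : C.homologyEulerChar = D.homologyEulerChar := by
  simp only [HomologicalComplex.homologyEulerChar, GradedObject.eulerChar]
  exact finsum_congr fun i =>
    by rw [LinearEquiv.finrank_eq (isoOfQuasiIsoAt f i).toLinearEquiv]

end Literature.Algebra.Homology.EulerCharShortExact
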